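import Literature.NumberTheory.ComplexMultiplication.EllipticUnits.ImaginaryQuadraticMainConjectureCarriersLevels
import HarnessLib

/-!
# EXISTENCE of the pinned carriers `H^i(𝒪_K[1/p𝔣], Λ(χ)(1)) = lim←_{n,k} H^i(G_S(K̃_n), μ_{p^k} ⊗ θ)`
# (`i = 0, 1, 2`) of Johnson-Leung–Kings 2011 Def. 4.2 (94) / Cor. 5.3 with their
# `Λ = ℤ_p⟦Gal(K_∞/K)⟧`-structure — part II: `Nonempty (JohnsonLeungKings2011.IwasawaCohomologyData p κ₁ κ₂ γ₁ γ₂ θ 𝔣 i)`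
# for EVERY number field, prime, pair of `ℤ_p`-extensions, pair of group elements, character and modulus

Topic `Literature/NumberTheory/ComplexMultiplication/EllipticUnits` (grouping sub-namespace
`JohnsonLeungKings2011`); part II of the cell's construction (M1)/F0a (part I:
`ImaginaryQuadraticMainConjectureCarriersLevels.lean`; the structure: ty2 g37's
`ImaginaryQuadraticMainConjectureCarriers.lean`, whose §5 docstring names this construction). Width seat
`bsd-line-cf2-p1-w5` g9 (cell `bsd-print-cf2`). One transparent definition (`iwasawaCohomologyData`), three
`letI`-definitions of module structures, theorems; no named fact, no `instance`, no `sorry`.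

THE CONSTRUCTION (Kato §8.2, JLK Def. 4.2 (94), Lang Ch. 5 §1): `H :=` the `Λ₂`-submodule
`compatibleFamilies` of `∏_{n,k} H^i(G_S(K̃_n), μ_{p^k} ⊗ θ)` (compatible with `layerCores` and `layerRed`) for
the LEVELWISE structures `T_i ↦ conj_{γ_i} − 1` (`IsLocNil₂.selfModule` on `isLocNil₂_layerConjEnd`, part I),
stable because the transitions intertwine the conjugations (`layerCores_layerConj`, `layerRed_layerConj`,
part I; `IsLocNil₂.map_smul_of_semiconj`); `proj n k :=` the coordinates; (P1)–(P8) are unfoldings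
(`IsLocNil₂.X_smul`, `C_X_smul`, `C_C_smul` with the UNIFORM `p^k`-torsion `levelCoh_torsion`). NO
hypothesis on `K`, `(γ₁, γ₂)`, `θ`, `𝔣`: **`iwasawaCohomologyDataExists`** (= the cell's item F0a).

## References
* [JohnsonLeungKings2011] J. reine angew. Math. 653 (2011) = arXiv:0804.2828, §4.2 Def. 4.2 (94) and the
  `Λ_𝒪`-module structure (p0012:L80–112); Cor. 5.3 (p0015:L1–20).
* [Kato2004Asterisque] K. Kato, Astérisque 295 (2004), §8.2 (p. 180), §12.2 (12.2.1) (p. 220).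
* [Lang1990] S. Lang, *Cyclotomic Fields I and II*, Ch. 5 §1 (Thm. 1.1).
-/

noncomputable section

open scoped NumberField
open CategoryTheory Field IsDedekindDomain
open Literature.NumberTheory.GaloisRepresentations
open Literature.NumberTheory.GaloisRepresentations.DiscreteGaloisModule
open Literature.NumberTheory.EllipticCurves Literature.NumberTheory.EllipticCurves.IwasawaDual

namespace Literature.NumberTheory.ComplexMultiplication.EllipticUnits.JohnsonLeungKings2011

/-! ## §3 The `Λ₂`-submodule of compatible families and the datum -/

section Construction

variable {K : Type} [Field K] [NumberField K] (p : ℕ) [Fact p.Prime]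
  (κ₁ κ₂ : ZpExtension K p) (γ₁ γ₂ : absoluteGaloisGroup K)
  (θ : absoluteGaloisGroup K →ₜ* ℤ_[p]ˣ) (𝔣 : Ideal (𝓞 K)) {i : ℕ} (hi : i ≤ 2)

/-- **The `Λ₂`-module structure of the layer group `H^i(G_S(K̃_n), μ_{p^k} ⊗ θ)`** (`i ≤ 2`):
`T₁ ↦ conj_{γ₁} − 1`, `T₂ ↦ conj_{γ₂} − 1` (`IsLocNil₂.selfModule`; activate with `letI`).
[cite: JohnsonLeungKings2011, §4.2 (arXiv p0012:L109–112)] [cite: Lang1990, Ch. 5 §1] -/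
@[reducible] def layerModule (n k : ℕ) : Module (IwasawaAlgebra₂ p) (layerCoh p κ₁ κ₂ θ 𝔣 n k i) :=
  (isLocNil₂_layerConjEnd p κ₁ κ₂ γ₁ γ₂ θ 𝔣 n k hi).selfModule

/-- The product `Λ₂`-module `∏_{n,k} H^i(G_S(K̃_n), μ_{p^k} ⊗ θ)` (activate with `letI`).
[cite: JohnsonLeungKings2011, Def. 4.2 (94) (arXiv p0012:L94)] -/
@[reducible] def piLayerModule : Module (IwasawaAlgebra₂ p) (∀ n k : ℕ, layerCoh p κ₁ κ₂ θ 𝔣 n k i) := by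
  letI : ∀ n k : ℕ, Module (IwasawaAlgebra₂ p) (layerCoh p κ₁ κ₂ θ 𝔣 n k i) :=
    fun n k ↦ layerModule p κ₁ κ₂ γ₁ γ₂ θ 𝔣 hi n k
  infer_instance

/-- The product action is componentwise. [cite: JohnsonLeungKings2011, Def. 4.2 (94) (arXiv p0012:L94)] -/
theorem piLayerModule_smul_apply (F : IwasawaAlgebra₂ p) (y : ∀ n k : ℕ, layerCoh p κ₁ κ₂ θ 𝔣 n k i) (n k : ℕ) :
    (letI := piLayerModule p κ₁ κ₂ γ₁ γ₂ θ 𝔣 hi; F • y) n k =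
      (letI := layerModule p κ₁ κ₂ γ₁ γ₂ θ 𝔣 hi n k; F • y n k) := rfl

/-- **`H^i(𝒪_K[1/p𝔣], Λ(χ)(1)) := lim←_{n,k} H^i(G_S(K̃_n), μ_{p^k} ⊗ θ)` as a `Λ₂`-SUBMODULE of the product**:
the compatible families (ty2's `IsCompatibleFamily`), stable under `Λ₂` because the corestrictions and the
reductions intertwine the conjugation operators (`layerCores_layerConj`, `layerRed_layerConj`,
`IsLocNil₂.map_smul_of_semiconj`). [cite: JohnsonLeungKings2011, Def. 4.2 (94) (arXiv p0012:L94)] [cite: Kato2004Asterisque, §8.2 (p. 180)] -/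
def compatibleFamilies :
    letI := piLayerModule p κ₁ κ₂ γ₁ γ₂ θ 𝔣 hi
    Submodule (IwasawaAlgebra₂ p) (∀ n k : ℕ, layerCoh p κ₁ κ₂ θ 𝔣 n k i) := by
  letI := piLayerModule p κ₁ κ₂ γ₁ γ₂ θ 𝔣 hi
  exact
    { carrier := {y | IsCompatibleFamily p κ₁ κ₂ θ 𝔣 i y}
      zero_mem' := ⟨fun n k ↦ by simp only [Pi.zero_apply, map_zero], fun n k ↦ by simp only [Pi.zero_apply, map_zero]⟩
      add_mem' := fun {y y'} hy hy' ↦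
        ⟨fun n k ↦ by simp only [Pi.add_apply, map_add, hy.1 n k, hy'.1 n k],
          fun n k ↦ by simp only [Pi.add_apply, map_add, hy.2 n k, hy'.2 n k]⟩
      smul_mem' := fun F y hy ↦ by
        refine ⟨fun n k ↦ ?_, fun n k ↦ ?_⟩
        · rw [piLayerModule_smul_apply, piLayerModule_smul_apply,
            (isLocNil₂_layerConjEnd p κ₁ κ₂ γ₁ γ₂ θ 𝔣 (n + 1) k hi).map_smul_of_semiconj
              (isLocNil₂_layerConjEnd p κ₁ κ₂ γ₁ γ₂ θ 𝔣 n k hi) (layerCores p κ₁ κ₂ θ 𝔣 n k i)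
              (fun s ↦ by
                simp only [End_sub_apply, AddMonoid.End.one_apply, map_sub]
                exact congrArg (· - _) (layerCores_layerConj p κ₁ κ₂ θ 𝔣 n k i γ₁ s))
              (fun s ↦ by
                simp only [End_sub_apply, AddMonoid.End.one_apply, map_sub]
                exact congrArg (· - _) (layerCores_layerConj p κ₁ κ₂ θ 𝔣 n k i γ₂ s)),
            hy.1 n k]
        · rw [piLayerModule_smul_apply, piLayerModule_smul_apply,
            (isLocNil₂_layerConjEnd p κ₁ κ₂ γ₁ γ₂ θ 𝔣 n (k + 1) hi).map_smul_of_semiconj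
              (isLocNil₂_layerConjEnd p κ₁ κ₂ γ₁ γ₂ θ 𝔣 n k hi) (layerRed p κ₁ κ₂ θ 𝔣 n k i)
              (fun s ↦ by
                simp only [End_sub_apply, AddMonoid.End.one_apply, map_sub]
                exact congrArg (· - _) (layerRed_layerConj p κ₁ κ₂ θ 𝔣 n k i γ₁ s))
              (fun s ↦ by
                simp only [End_sub_apply, AddMonoid.End.one_apply, map_sub]
                exact congrArg (· - _) (layerRed_layerConj p κ₁ κ₂ θ 𝔣 n k i γ₂ s)),
            hy.2 n k] }

/-- Membership in `compatibleFamilies` (unfolding). [cite: JohnsonLeungKings2011, Def. 4.2 (94) (arXiv p0012:L94)] -/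
theorem mem_compatibleFamilies_iff (y : ∀ n k : ℕ, layerCoh p κ₁ κ₂ θ 𝔣 n k i) :
    (letI := piLayerModule p κ₁ κ₂ γ₁ γ₂ θ 𝔣 hi; y ∈ compatibleFamilies p κ₁ κ₂ γ₁ γ₂ θ 𝔣 hi) ↔
      IsCompatibleFamily p κ₁ κ₂ θ 𝔣 i y := Iff.rfl

/-- **THE PINNED DATUM `H^i(𝒪_K[1/p𝔣], Λ(χ)(1))`, CONSTRUCTED** (`i ≤ 2`): `H :=` the compatible families with
the `Λ₂`-structure `T_i ↦ conj_{γ_i} − 1` levelwise, `proj n k :=` the coordinates; the pins (P1)–(P8) are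
unfoldings (`IsLocNil₂.X_smul`, `C_X_smul`, `C_C_smul` with the UNIFORM `p^k`-torsion `levelCoh_torsion`).
[cite: JohnsonLeungKings2011, §4.2 Def. 4.2 (94) and the Λ_𝒪-module structure (arXiv p0012:L80–112)] [cite: Kato2004Asterisque, §8.2 (p. 180), §12.2 (12.2.1) (p. 220)] [cite: Lang1990, Ch. 5 §1] -/
def iwasawaCohomologyData : IwasawaCohomologyData p κ₁ κ₂ γ₁ γ₂ θ 𝔣 i :=
  letI := piLayerModule p κ₁ κ₂ γ₁ γ₂ θ 𝔣 hi
  { H := ↥(compatibleFamilies p κ₁ κ₂ γ₁ γ₂ θ 𝔣 hi)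
    proj := fun n k ↦
      { toFun := fun y ↦ (y : ∀ n k : ℕ, layerCoh p κ₁ κ₂ θ 𝔣 n k i) n k
        map_zero' := rfl
        map_add' := fun _ _ ↦ rfl }
    proj_cores := fun n k y ↦ y.2.1 n k
    proj_red := fun n k y ↦ y.2.2 n k
    proj_injective := fun y hy ↦ Subtype.ext (funext fun n ↦ funext fun k ↦ hy n k)
    proj_surjective := fun y hy ↦ ⟨⟨y, hy⟩, fun _ _ ↦ rfl⟩
    proj_T₁_smul := fun n k y ↦ by
      change (letI := layerModule p κ₁ κ₂ γ₁ γ₂ θ 𝔣 hi n k;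
        (PowerSeries.X : IwasawaAlgebra₂ p) • (y : ∀ n k : ℕ, layerCoh p κ₁ κ₂ θ 𝔣 n k i) n k) = _
      rw [IsLocNil₂.X_smul]
      rfl
    proj_T₂_smul := fun n k y ↦ by
      change (letI := layerModule p κ₁ κ₂ γ₁ γ₂ θ 𝔣 hi n k;
        (PowerSeries.C (PowerSeries.X : IwasawaAlgebra p) : IwasawaAlgebra₂ p) •
          (y : ∀ n k : ℕ, layerCoh p κ₁ κ₂ θ 𝔣 n k i) n k) = _
      rw [IsLocNil₂.C_X_smul]
      rfl
    proj_C_smul := fun c n k y ↦ by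
      change (letI := layerModule p κ₁ κ₂ γ₁ γ₂ θ 𝔣 hi n k;
        (PowerSeries.C (PowerSeries.C c : IwasawaAlgebra p) : IwasawaAlgebra₂ p) •
          (y : ∀ n k : ℕ, layerCoh p κ₁ κ₂ θ 𝔣 n k i) n k) = _
      rw [IsLocNil₂.C_C_smul _ c
        (levelCoh_torsion p (suppPF p 𝔣) θ (isOpen_pairLayerSubgroup κ₁ κ₂ n) k i _),
        ← natCast_zsmul]
      rfl
    proj_smul_eq_zero := fun n k F y hy ↦ by
      letI := layerModule p κ₁ κ₂ γ₁ γ₂ θ 𝔣 hi n k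
      change F • (y : ∀ n k : ℕ, layerCoh p κ₁ κ₂ θ 𝔣 n k i) n k = 0
      have hy' : (y : ∀ n k : ℕ, layerCoh p κ₁ κ₂ θ 𝔣 n k i) n k = 0 := hy
      rw [hy', smul_zero] }

include hi in
/-- **`Nonempty (IwasawaCohomologyData p κ₁ κ₂ γ₁ γ₂ θ 𝔣 i)` for `i ≤ 2`** — no hypothesis on the number field
`K`, the prime `p`, the `ℤ_p`-extensions `κ₁, κ₂`, the elements `γ₁, γ₂ ∈ Γ_K`, the character `θ` or the modulus
`𝔣`. [cite: JohnsonLeungKings2011, §4.2 Def. 4.2 (94) (arXiv p0012:L80–112)] [cite: Kato2004Asterisque, §8.2 (p. 180)] -/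
theorem nonempty_iwasawaCohomologyData : Nonempty (IwasawaCohomologyData p κ₁ κ₂ γ₁ γ₂ θ 𝔣 i) :=
  ⟨iwasawaCohomologyData p κ₁ κ₂ γ₁ γ₂ θ 𝔣 hi⟩

end Construction

/-- **F0a — EXISTENCE OF THE THREE PINNED CARRIERS `H⁰, H¹, H²` of [JLK] Def. 4.2 (94) / Cor. 5.3** for every
number field, prime, pair of `ℤ_p`-extensions, pair of elements, continuous character and modulus (the cell's
construction (M1), carrier half; the unit pins `aZeta`, `artin` of `TwistedIwasawaData` are the other half).
[cite: JohnsonLeungKings2011, §4.2 Def. 4.2 (94) (arXiv p0012:L80–112), Cor. 5.3 (p0015:L1–20)] [cite: Kato2004Asterisque, §8.2 (p. 180)] -/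
theorem iwasawaCohomologyDataExists :
    ∀ (K : Type) [Field K] [NumberField K] (p : ℕ) [Fact p.Prime] (κ₁ κ₂ : ZpExtension K p)
      (γ₁ γ₂ : absoluteGaloisGroup K) (θ : absoluteGaloisGroup K →ₜ* ℤ_[p]ˣ) (𝔣 : Ideal (𝓞 K)),
      Nonempty (IwasawaCohomologyData p κ₁ κ₂ γ₁ γ₂ θ 𝔣 0) ∧ Nonempty (IwasawaCohomologyData p κ₁ κ₂ γ₁ γ₂ θ 𝔣 1) ∧
        Nonempty (IwasawaCohomologyData p κ₁ κ₂ γ₁ γ₂ θ 𝔣 2) :=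
  fun _ _ _ p _ κ₁ κ₂ γ₁ γ₂ θ 𝔣 ↦
    ⟨nonempty_iwasawaCohomologyData p κ₁ κ₂ γ₁ γ₂ θ 𝔣 (Nat.zero_le 2),
      nonempty_iwasawaCohomologyData p κ₁ κ₂ γ₁ γ₂ θ 𝔣 (by norm_num),
      nonempty_iwasawaCohomologyData p κ₁ κ₂ γ₁ γ₂ θ 𝔣 le_rfl⟩




end Literature.NumberTheory.ComplexMultiplication.EllipticUnits.JohnsonLeungKings2011

end
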